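import Literature.MathematicalPhysics.QuantumFieldTheory.Balaban1983to89.B14Eq367Assembly
import Literature.MathematicalPhysics.QuantumFieldTheory.Balaban1983to89.B12TreeDecay

/-!
# `Balaban1983to89.B14.Thm2Assembly` — T. Bałaban, *Convergent renormalization expansions for lattice gauge theories*,
# Commun. Math. Phys. **119** (1988) 243–285 [Balaban1988Convergent]: THEOREM 2 ((2.43)–(2.44) p. 263) in the cell's
# typed form `B14.Thm2Printed` DERIVED from per-point display-level data of §3 (pp. 279–283) — the E-side via (3.67)
# (`B14.Eq367Assembly`), the 𝐑-side via the last paragraph of p. 283 and the tree-decay summability (1.26) of [II]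

statement-level skeleton of published theorems with citation tags; proofs where landed; nothing here is a claim about the Yang–Mills mass gap

PDF held: `paper:balaban1988-cmp119-convergent-renormalization` (journal page = PDF page + 242); pp. 263, 279–283 [PDF 21, 37–41]
read from the OCR text layer and the x2 renders of the cell `pub-balaban`.

CITATION HEADER (lean-in-tree rule).  WHAT IS REPRODUCED, verbatim.  [Balaban1988Convergent] Theorem 2 p. 263: *"Under the
assumptions of Theorem 1 there exists a constant E₁ independent of j, k, Ω, {Ω_j}, {Λ_j}, T …, such that |Σ_{z∈Λ_j⁰∩Ω}
[𝐄^{(j)}(Λ_j, U_k, z) − 𝐄^{(j)}(Λ_j, 1, z)] − β_j(g_{j−1})A(φ, U_k)| ≤ E₁Σ_{n=j}^{k}(L^{j−n})^β|Γ_n∩Ω| (2.43) for β < 1 …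
The constant E₁ depends on β also, and grows to ∞ if β → 1. … there exists an absolute constant R₁ such, that |Σ_{X∈𝐃_j,
X⊂Λ_j, X∩Ω≠∅}[𝐑^{(j)}(X, U_k) − 𝐑^{(j)}(X, 1)]| ≤ R₁g_j^{κ₀}Σ_{n=j}^{k}|Γ_n∩Ω| (2.44)"*; p. 283: *"𝐄^{(j)}(Λ_j, U_k, z) −
𝐄^{(j)}(Λ_j, 1, z) − β_jA(h_z, U_k) = O((LʲL⁻ⁿ)^{5−β}), (3.67) for z ∈ Λ_j⁰∩(Ω_n∖Ω_{n+1}), β > 0. Summing over z ∈ Λ_j⁰∩Ω w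
get the inequality (2.43) in Theorem 2 (with 1 − β, β > 0, instead of β < 1). … The inequality (2.44) for the functions
𝐑^{(j)} can be proved in an almost identical way. We analyze these functions as above, but we stop at the identity (3.49),
where 𝐄^{(2)}(X, x, y, z) is replaced by 𝐑^{(2)}(X, x, y), and z is an arbitrary point from X. Now all the terms on the
right-hand side can be bounded by O(1)(LʲL⁻ⁿ)⁴g_j^{κ₀} exp(−κd_j(X)), and this yields the inequality (2.44). The proof of
Theorem 2 is completed."*  [Balaban1988RG2Cluster] (1.26) p. 8: *"Σ_{X∈𝐃_j, X⊃□′} exp(−κd_j(X)) ≤ O(1)"*.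

SKELETON rows (owner r11): **B14.Thm2** (`B14.Thm2Printed`, typed-existing; proof-side so far: the summation hypotheses
`B14Sect3.Rep367`/`Rep244` ⇒ `Ineq243`/`Ineq244`), **B14.Claim@283R** (the 𝐑-side paragraph), **B14.Eq3.67**.  WHAT IS
PROVED HERE.  §1 `PointDataE` packages, per run, the per-point DISPLAY-LEVEL inputs of the E-side exactly as consumed by
`B14.Eq367Assembly.ineq243_of_pointData` ((2.27) split at z, (3.61) first class = β′Q + I₁, (3.66) A(h_z) = Q + I₂, (3.64)
β′ = β_j, the three irrelevant bounds with exponent `5 − b`, the p. 263 point count); `PointDataR` packages the 𝐑-side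
((2.44)'s left-hand side as a sum of per-point terms bounded by `c′g_j^{κ₀}(L^{j−n})⁴` = `B14Sect3.Rep244`).  §2 the 𝐑-side
per-point bound FROM the printed per-domain bound: *"all the terms … bounded by O(1)(LʲL⁻ⁿ)⁴g_j^{κ₀}exp(−κd_j(X))"* summed
over the domains above the cube of z by (1.26) (`B12TreeDecay.ineq126_of_volumeLeaf`): `perPointR_of_domainBound` —
`|Σ_{X∋□_z} r(X)| ≤ O(1)K₀(c₀,Δ)·s⁴g_j^{κ₀}`.  §3 **`thm2Printed_of_pointData`** — for a FAMILY of runs (the printed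
uniformity in T, {Ω_j}, {Λ_j}): if for every `b > 0` there are constants, uniform over the family, with `PointDataE` for
every run (E₁'s dependence on β), and constants with `PointDataR` for every run, then `B14.Thm2Printed H033 fam L β κ₀`
holds for EVERY hypothesis parameter `H033` (the data already carry the content; Theorem 1's hypotheses are not used by
this summation step) — with `E₁ = c₁(b) + β̄(b)c₂(b) + c₃(b)` at `b = 1 − β` and `R₁ = c′`.  NOT HERE: that Bałaban's
functions satisfy the point data (pp. 279–283, [I] §§4–5).  Two hypothesis-packaging `def`s + theorems; no `sorry`.

Mega-formalization `lit-balaban`, unit `lit-balaban-r11` gen 5 (B14 fold owner), HOME `run/shared/lean/pub/lit-balaban/`.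

## References
* [Balaban1988Convergent] T. Bałaban, Commun. Math. Phys. 119 (1988) 243–285, Thm 2 (2.43)–(2.44) p.263, (3.67) p.283.
* [Balaban1988RG2Cluster] T. Bałaban, Commun. Math. Phys. 116 (1988) 1–22 ([II]: (1.26) p.8).
-/

namespace Literature.MathematicalPhysics.QuantumFieldTheory.Balaban1983to89.B14.Thm2Assembly

open Finset
open Literature.MathematicalPhysics.QuantumFieldTheory.Balaban1983to89
open Literature.MathematicalPhysics.QuantumFieldTheory.Balaban1983to89.B12TreeDecay

/-! ## §1. The per-point data of §3, packaged per run -/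

/-- **The E-side per-point data of a run** (pp. 279–283, as consumed by `B14.Eq367Assembly.ineq243_of_pointData`): for
every `(j, k, Ω)` the left-hand side of (2.43) is a sum over finitely many points `z` (scales `n = sc z ∈ [j, k]`, at most
`(L^{n−j})⁴|Γ_n∩Ω|` of scale `n`) of `(F + G) − β_j·A` with (2.27) first/second-class split `F`, `G`, (3.61) `F = β′Q + I₁`,
(3.66) `A = Q + I₂`, (3.64) `β′ = β_j`, `|β_j| ≤ β̄`, and the irrelevant bounds `|I₁| ≤ c₁w`, `|I₂| ≤ c₂w`, `|G| ≤ c₃w`,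
`w = (L^{j−n})^{5−b}`. [cite: Balaban1988Convergent, (3.67) p.283] -/
def PointDataE (S : B14.Sect2Data) (L c₁ c₂ c₃ βbar b : ℝ) : Prop :=
  ∀ j k ω, 1 ≤ j → j ≤ k → k ≤ S.K →
    ∃ (Z : Finset ℕ) (sc : ℕ → ℕ) (F G A Q I₁ I₂ βj β' : ℕ → ℝ),
      S.eTerm j k ω = ∑ z ∈ Z, ((F z + G z) - βj z * A z) ∧
      (∀ z ∈ Z, j ≤ sc z ∧ sc z ≤ k) ∧
      (∀ z ∈ Z, F z = β' z * Q z + I₁ z ∧ A z = Q z + I₂ z ∧ β' z = βj z ∧ |βj z| ≤ βbar ∧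
        |I₁ z| ≤ c₁ * (L ^ ((j : ℝ) - sc z)) ^ (5 - b) ∧ |I₂ z| ≤ c₂ * (L ^ ((j : ℝ) - sc z)) ^ (5 - b) ∧
        |G z| ≤ c₃ * (L ^ ((j : ℝ) - sc z)) ^ (5 - b)) ∧
      (∀ n, ((Z.filter (fun z => sc z = n)).card : ℝ) ≤ (L ^ ((n : ℝ) - j)) ^ (4 : ℝ) * S.gammaVol n ω)

/-- **The 𝐑-side per-point data of a run** (p. 283, last paragraph): the left-hand side of (2.44) as a sum of per-point
terms bounded by `c′g_j^{κ₀}(L^{j−n})⁴` with the same point count — literally `B14Sect3.Rep244 S L c′ κ₀`.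
[cite: Balaban1988Convergent, (2.44) p.263, p.283] -/
def PointDataR (S : B14.Sect2Data) (L c' : ℝ) (κ₀ : ℕ) : Prop := B14Sect3.Rep244 S L c' κ₀

/-- `PointDataE` is the hypothesis of `B14.Eq367Assembly.ineq243_of_pointData`: it gives (2.43) with `E₁ = c₁ + β̄c₂ + c₃`
and exponent `1 − b`. [cite: Balaban1988Convergent, (2.43) p.263, (3.67) p.283] -/
theorem ineq243_of_pointDataE (S : B14.Sect2Data) {L c₁ c₂ c₃ βbar b : ℝ} (hL : 0 < L) (hc₁ : 0 ≤ c₁) (hc₂ : 0 ≤ c₂)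
    (hc₃ : 0 ≤ c₃) (hβ : 0 ≤ βbar) (h : PointDataE S L c₁ c₂ c₃ βbar b) :
    B14Thm2.Ineq243 S L (1 - b) (c₁ + βbar * c₂ + c₃) :=
  Eq367Assembly.ineq243_of_pointData S L c₁ c₂ c₃ βbar b hL hc₁ hc₂ hc₃ hβ h

/-- `PointDataR` gives (2.44) with `R₁ = c′` (`B14Sect3.ineq244_of_rep244`; `g_j ≥ 0`).
[cite: Balaban1988Convergent, (2.44) p.263, p.283] -/
theorem ineq244_of_pointDataR (S : B14.Sect2Data) {L c' : ℝ} {κ₀ : ℕ} (hL : 0 < L) (hc' : 0 ≤ c')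
    (hg : ∀ j, 0 ≤ S.flow.g j) (h : PointDataR S L c' κ₀) : B14Thm2.Ineq244 S c' κ₀ :=
  B14Sect3.ineq244_of_rep244 S L c' κ₀ hL hc' hg h

/-! ## §2. The 𝐑-side per-point bound from the printed per-domain bound and (1.26) of [II] -/

section RSide

variable {Sy : LocDomainSys} (G : CubeSystem Sy)

/-- **p. 283, the 𝐑-side per-point term**: if every domain `X` above the cube `□_z` of `z` contributes `r(X)` with
*"|r(X)| ≤ O(1)(LʲL⁻ⁿ)⁴g_j^{κ₀}exp(−κd_j(X))"* (`c·s⁴g^{κ₀}e^{−κd_j(X)}`, `s = LʲL⁻ⁿ`), then the per-point term `Σ_{X∋□_z} r(X)`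
is bounded by `c·K₀(c₀,Δ)·s⁴g^{κ₀}` for `κ ≥ κ₀(c₀,Δ)` — the tree-decay summability (1.26) of [II]
(`B12TreeDecay.ineq126_of_volumeLeaf`, modulo its quoted leaf). [cite: Balaban1988Convergent, p.283] -/
theorem perPointR_of_domainBound {Δ : ℕ} (hΔ : G.DegreeLE Δ) {c₀ : ℝ} (hV : G.VolumeLeaf c₀) {κ : ℝ}
    (hκ : kappa₀ c₀ Δ ≤ κ) {r : Sy.Dom → ℝ} {c s g : ℝ} {κ₀' : ℕ} (hc : 0 ≤ c) (hs : 0 ≤ s) (hg : 0 ≤ g) (cz : G.Cube)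
    (hr : ∀ X ∈ G.above cz, |r X| ≤ c * s ^ 4 * g ^ κ₀' * Real.exp (-κ * Sy.dj X)) :
    |∑ X ∈ G.above cz, r X| ≤ c * K₀ c₀ Δ * s ^ 4 * g ^ κ₀' := by
  have h126 := ineq126_of_volumeLeaf G hΔ hV hκ cz
  have hw : 0 ≤ c * s ^ 4 * g ^ κ₀' := mul_nonneg (mul_nonneg hc (pow_nonneg hs 4)) (pow_nonneg hg _)
  calc |∑ X ∈ G.above cz, r X| ≤ ∑ X ∈ G.above cz, |r X| := Finset.abs_sum_le_sum_abs _ _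
    _ ≤ ∑ X ∈ G.above cz, c * s ^ 4 * g ^ κ₀' * Real.exp (-κ * Sy.dj X) := Finset.sum_le_sum hr
    _ = c * s ^ 4 * g ^ κ₀' * ∑ X ∈ G.above cz, Real.exp (-κ * Sy.dj X) := by rw [Finset.mul_sum]
    _ ≤ c * s ^ 4 * g ^ κ₀' * K₀ c₀ Δ := mul_le_mul_of_nonneg_left h126 hw
    _ = c * K₀ c₀ Δ * s ^ 4 * g ^ κ₀' := by ring

/-- The same in the `Rep244` normal form `(c′·g^{κ₀})·(L^{j−n})⁴` with `c′ = cK₀(c₀,Δ)` and `s = L^{j−n}` written as a real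
power. [cite: Balaban1988Convergent, p.283] -/
theorem perPointR_rep244_shape {Δ : ℕ} (hΔ : G.DegreeLE Δ) {c₀ : ℝ} (hV : G.VolumeLeaf c₀) {κ : ℝ}
    (hκ : kappa₀ c₀ Δ ≤ κ) {r : Sy.Dom → ℝ} {c L g : ℝ} {j n κ₀' : ℕ} (hc : 0 ≤ c) (hL : 0 < L) (hg : 0 ≤ g)
    (cz : G.Cube)
    (hr : ∀ X ∈ G.above cz, |r X| ≤ c * (L ^ ((j : ℝ) - n)) ^ 4 * g ^ κ₀' * Real.exp (-κ * Sy.dj X)) :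
    |∑ X ∈ G.above cz, r X| ≤ (c * K₀ c₀ Δ * g ^ κ₀') * (L ^ ((j : ℝ) - n)) ^ (4 : ℝ) := by
  have h := perPointR_of_domainBound G hΔ hV hκ hc (Real.rpow_nonneg hL.le _) hg cz hr
  have e : (L ^ ((j : ℝ) - n)) ^ (4 : ℝ) = (L ^ ((j : ℝ) - n)) ^ 4 := by
    exact_mod_cast Real.rpow_natCast (L ^ ((j : ℝ) - n)) 4
  rw [e]
  calc |∑ X ∈ G.above cz, r X| ≤ c * K₀ c₀ Δ * (L ^ ((j : ℝ) - n)) ^ 4 * g ^ κ₀' := h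
    _ = (c * K₀ c₀ Δ * g ^ κ₀') * (L ^ ((j : ℝ) - n)) ^ 4 := by ring

end RSide

/-! ## §3. Theorem 2 in the typed form `B14.Thm2Printed` from the per-point data -/

/-- **Theorem 2 ⇐ the per-point data of §3, one run**: `PointDataE` (with exponent `b = 1 − β`) and `PointDataR` give both
conjuncts `Ineq243 S L β (c₁ + β̄c₂ + c₃)` and `Ineq244 S c′ κ₀`. [cite: Balaban1988Convergent, Thm 2 p.263] -/
theorem thm2_conjuncts_of_pointData (S : B14.Sect2Data) {L β c₁ c₂ c₃ βbar c' : ℝ} {κ₀ : ℕ} (hL : 0 < L)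
    (hc₁ : 0 ≤ c₁) (hc₂ : 0 ≤ c₂) (hc₃ : 0 ≤ c₃) (hβbar : 0 ≤ βbar) (hc' : 0 ≤ c') (hg : ∀ j, 0 ≤ S.flow.g j)
    (hE : PointDataE S L c₁ c₂ c₃ βbar (1 - β)) (hR : PointDataR S L c' κ₀) :
    B14Thm2.Ineq243 S L β (c₁ + βbar * c₂ + c₃) ∧ B14Thm2.Ineq244 S c' κ₀ := by
  have h := ineq243_of_pointDataE S hL hc₁ hc₂ hc₃ hβbar hE
  rw [sub_sub_cancel] at h
  exact ⟨h, ineq244_of_pointDataR S hL hc' hg hR⟩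

/-- **Theorem 2 (`B14.Thm2Printed`) from the per-point data, for a FAMILY of runs** (the printed uniformity *"independent of
j, k, Ω, {Ω_j}, {Λ_j}, T"*): if for every `b > 0` there are constants `c₁, c₂, c₃, β̄ ≥ 0`, uniform over the family, with
`PointDataE (fam i) L c₁ c₂ c₃ β̄ b` for every run (*"The constant E₁ depends on β also"*), and constants `c′ ≥ 0, κ₀` with
`PointDataR (fam i) L c′ κ₀` for every run, and the couplings are nonnegative, then `B14.Thm2Printed H033 fam L β κ₀` holds
(for every β; the typed statement carries its own guard `β < 1`, used to produce `b = 1 − β > 0`).  The hypothesis parameter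
`H033` and `SatisfiesRG` of Theorem 1 are not used by this summation step (the data carry the content).
[cite: Balaban1988Convergent, Thm 2 (2.43)–(2.44) p.263, (3.67) p.283] -/
theorem thm2Printed_of_pointData (H033 : Flow → ℕ → Prop) {I : Type} (fam : I → B14.Sect2Data) (L β : ℝ)
    (κ₀ : ℕ) (hL : 0 < L) (hg : ∀ i j, 0 ≤ (fam i).flow.g j)
    (hE : ∀ b : ℝ, 0 < b → ∃ c₁ c₂ c₃ βbar : ℝ, 0 ≤ c₁ ∧ 0 ≤ c₂ ∧ 0 ≤ c₃ ∧ 0 ≤ βbar ∧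
      ∀ i, PointDataE (fam i) L c₁ c₂ c₃ βbar b)
    (hR : ∃ c' : ℝ, 0 ≤ c' ∧ ∀ i, PointDataR (fam i) L c' κ₀) :
    B14.Thm2Printed H033 fam L β κ₀ := by
  intro hβ
  obtain ⟨c₁, c₂, c₃, βbar, hc₁, hc₂, hc₃, hβbar, hEi⟩ := hE (1 - β) (by linarith)
  obtain ⟨c', hc', hRi⟩ := hR
  refine ⟨c₁ + βbar * c₂ + c₃, c', fun i _ _ => ?_⟩
  have h := thm2_conjuncts_of_pointData (fam i) hL hc₁ hc₂ hc₃ hβbar hc' (hg i) (hEi i) (hRi i)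
  exact ⟨h.1, h.2⟩

end Literature.MathematicalPhysics.QuantumFieldTheory.Balaban1983to89.B14.Thm2Assembly
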